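import Mathlib
import HarnessLib
import Summits.HubbardSuperconductivity.HubbardSuperconductivity.Theorems.KLProgrammeSalmhoferCutoffSecondDerivSharp
import Summits.HubbardSuperconductivity.HubbardSuperconductivity.Theorems.KLProgrammeKLRegimeSplitEdgeFactsTransfer

/-!
# Route `KLProgramme` — edge facts for the pair masses ACROSS TRANSFERS, IV: first and second DIFFERENCES OF THE CUTOFF WEIGHT `w^K_Λ(ν,·)` and of the
# complementary member symbol in the momentum, from the band differences (the profile half of the jet rows behind the shortfall (D2))

Cell gate-hubbard-kl, seat hubbard-kl-k3c1-p1 (g20; child-1 lineage).  Companion of `…SplitEdgeFactsRungSecondDiff` (row 18: `‖δ²_Q(φ·ĝ_K)‖` reduced to `|δφ|`,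
`|δ²φ|`, `|δe_K|`, `|δ²e_K|`, `‖ĝ_K‖`).  The ladder's symbols are the CT cutoff weight `w^K_Λ(ν,p) = χ₂((ω_ν² + e_K(p)²)/Λ²)` (`hubbardCutoffWeightCT`) and differences of two of
them (`softSymbolCompl … n m = w_{Λ_m} − w_{Λ_n}`); `χ₂ = salmhoferCutoff` has `|χ₂′| ≤ 8/3`, `|χ₂″| ≤ 176/9` in the tree (`klsh_abs_deriv_salmhoferCutoff_le`,
`klsh_abs_deriv2_salmhoferCutoff_le`, k3c3 lineage).  THIS FILE turns those into FINITE-DIFFERENCE rows in the momentum: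

* §1 the generic SECOND-DIFFERENCE CHAIN RULE on `ℝ`: `f` differentiable with `|f′| ≤ M₁`, `f′` differentiable with `|f″| ≤ M₂` ⟹
  `|f(y) − f(x) − f′(x)(y − x)| ≤ M₂·(y − x)²` (`abs_taylor1_le_of_deriv2`, mean value twice) and
  **`|f(x₂) − 2f(x₁) + f(x₀)| ≤ M₁·|x₂ − 2x₁ + x₀| + M₂·((x₂ − x₁)² + (x₀ − x₁)²)`** (`abs_secondDiff_comp_le`);
* §2 the cutoff argument `u = (ω² + e²)/Λ²` at three momenta: `u₂ − u₁ = (e₂ − e₁)(e₂ + e₁)/Λ²`, `u₂ − 2u₁ + u₀ = (2e₁(e₂ − 2e₁ + e₀) + (e₂−e₁)² + (e₀−e₁)²)/Λ²`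
  (`cutoffArg_sub`, `cutoffArg_secondDiff`);
* §3 the CT weight: `|w_Λ(ν,p+Q) − w_Λ(ν,p)| ≤ (8/3)·|u(p+Q) − u(p)|` (`abs_hubbardCutoffWeightCT_sub_le`) and
  **`|w_Λ(ν,p+Q) − 2w_Λ(ν,p) + w_Λ(ν,p−Q)| ≤ (8/3)·|δ²_Q u(p)| + (176/9)·((δ⁺u)² + (δ⁻u)²)`** (`abs_hubbardCutoffWeightCT_secondDiff_le`), `u = (ω_ν² + e_K(·)²)/Λ²`
  written out through §2; the complementary member by the triangle inequality (`abs_softSymbolCompl_secondDiff_le`).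

With the band jets `|δ^±_Q e_K| ≤ v|p_Q|`, `|δ²_Q e_K| ≤ κ|p_Q|²` (E1, trig-polynomial rows) and `|e_K| ≲ Λ` on the support these are `O((|p_Q|/Λ)²)`-rows, the rate rows 16/18
consume.  Everything is proved; no definitions; nothing asserts any slot, stub, K3 or superconductivity. [folklore]
-/

noncomputable section

namespace Summit.HubbardSuperconductivity.HubbardSuperconductivity.Theorems.KLRegimeSplit

set_option linter.dupNamespace false -- summit = problem name (single-conjunct summit), D-0017

open Real Finset Literature.MathematicalPhysics.QuantumLattice Literature.Probability.LatticeModels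
open Literature.MathematicalPhysics.QuantumLattice.FermiRG
open Summit.HubbardSuperconductivity.HubbardSuperconductivity.Theorems.KLProgrammeLegKernels
open Summit.HubbardSuperconductivity.HubbardSuperconductivity.Theorems.TwoPointAssembly

/-! ## §1 The second-difference chain rule on `ℝ` -/

section ChainRule

variable {f : ℝ → ℝ} {M₁ M₂ : ℝ}

/-- **Taylor to first order with a second-derivative bound** (mean value twice): `f` differentiable, `f′` differentiable with `|f″| ≤ M₂` everywhere ⟹
`|f(y) − f(x) − f′(x)·(y − x)| ≤ M₂·(y − x)²`. [folklore] -/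
theorem abs_taylor1_le_of_deriv2 (hf : Differentiable ℝ f) (hf' : Differentiable ℝ (deriv f)) (h2 : ∀ x, |deriv (deriv f) x| ≤ M₂) (x y : ℝ) :
    |f y - f x - deriv f x * (y - x)| ≤ M₂ * (y - x) ^ 2 := by
  have hM₂ : 0 ≤ M₂ := (abs_nonneg _).trans (h2 0)
  -- `f′` is `M₂`-Lipschitz
  have hL : ∀ z, |deriv f z - deriv f x| ≤ M₂ * |z - x| := fun z => by
    have h := Convex.norm_image_sub_le_of_norm_deriv_le (f := deriv f) (s := Set.univ) (fun z _ => hf'.differentiableAt)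
      (fun z _ => by rw [Real.norm_eq_abs]; exact h2 z) convex_univ (Set.mem_univ x) (Set.mem_univ z)
    simpa only [Real.norm_eq_abs] using h
  -- `h(z) = f z − f′(x)·z` has derivative `f′(z) − f′(x)`, bounded by `M₂|y − x|` on the segment
  set c := deriv f x with hc
  have hh : ∀ z, HasDerivAt (fun z => f z - c * z) (deriv f z - c) z := fun z => by
    have h1 : HasDerivAt f (deriv f z) z := (hf z).hasDerivAt
    have h2' : HasDerivAt (fun y : ℝ => c * y) (c * 1) z := (hasDerivAt_id z).const_mul c
    rw [mul_one] at h2'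
    exact h1.sub h2'
  have hbound : ∀ z ∈ Set.uIcc x y, ‖deriv (fun z => f z - c * z) z‖ ≤ M₂ * |y - x| := fun z hz => by
    rw [(hh z).deriv, Real.norm_eq_abs]
    exact (hL z).trans (mul_le_mul_of_nonneg_left (Set.abs_sub_left_of_mem_uIcc hz) hM₂)
  have hmv := Convex.norm_image_sub_le_of_norm_deriv_le (fun z _ => (hh z).differentiableAt) hbound (convex_uIcc x y)
    Set.left_mem_uIcc Set.right_mem_uIcc
  rw [Real.norm_eq_abs, Real.norm_eq_abs] at hmv
  calc |f y - f x - deriv f x * (y - x)| = |f y - c * y - (f x - c * x)| := by rw [hc]; ring_nf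
    _ ≤ M₂ * |y - x| * |y - x| := hmv
    _ = M₂ * (y - x) ^ 2 := by rw [mul_assoc, ← sq, sq_abs]

/-- **The second-difference chain rule**: `f` differentiable with `|f′| ≤ M₁`, `f′` differentiable with `|f″| ≤ M₂` ⟹ for any three points
`|f(x₂) − 2f(x₁) + f(x₀)| ≤ M₁·|x₂ − 2x₁ + x₀| + M₂·((x₂ − x₁)² + (x₀ − x₁)²)`. [folklore] -/
theorem abs_secondDiff_comp_le (hf : Differentiable ℝ f) (hf' : Differentiable ℝ (deriv f)) (h1 : ∀ x, |deriv f x| ≤ M₁)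
    (h2 : ∀ x, |deriv (deriv f) x| ≤ M₂) (x₀ x₁ x₂ : ℝ) :
    |f x₂ - 2 * f x₁ + f x₀| ≤ M₁ * |x₂ - 2 * x₁ + x₀| + M₂ * ((x₂ - x₁) ^ 2 + (x₀ - x₁) ^ 2) := by
  have t2 := abs_taylor1_le_of_deriv2 hf hf' h2 x₁ x₂
  have t0 := abs_taylor1_le_of_deriv2 hf hf' h2 x₁ x₀
  have hid : f x₂ - 2 * f x₁ + f x₀ =
      (f x₂ - f x₁ - deriv f x₁ * (x₂ - x₁)) + (f x₀ - f x₁ - deriv f x₁ * (x₀ - x₁)) + deriv f x₁ * (x₂ - 2 * x₁ + x₀) := by ring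
  rw [hid]
  refine (abs_add_three _ _ _).trans ?_
  rw [abs_mul]
  have h3 : |deriv f x₁| * |x₂ - 2 * x₁ + x₀| ≤ M₁ * |x₂ - 2 * x₁ + x₀| := mul_le_mul_of_nonneg_right (h1 x₁) (abs_nonneg _)
  linarith

end ChainRule

/-! ## §2 The cutoff argument `u = (ω² + e²)/Λ²` at three momenta -/

/-- First difference of the cutoff argument: `(ω² + e₂²)/Λ² − (ω² + e₁²)/Λ² = (e₂ − e₁)(e₂ + e₁)/Λ²`. [folklore] -/
theorem cutoffArg_sub (ω e₁ e₂ Λ : ℝ) :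
    (ω ^ 2 + e₂ ^ 2) / Λ ^ 2 - (ω ^ 2 + e₁ ^ 2) / Λ ^ 2 = (e₂ - e₁) * (e₂ + e₁) / Λ ^ 2 := by ring

/-- Second difference of the cutoff argument: `u₂ − 2u₁ + u₀ = (2e₁(e₂ − 2e₁ + e₀) + (e₂ − e₁)² + (e₀ − e₁)²)/Λ²`. [folklore] -/
theorem cutoffArg_secondDiff (ω e₀ e₁ e₂ Λ : ℝ) :
    (ω ^ 2 + e₂ ^ 2) / Λ ^ 2 - 2 * ((ω ^ 2 + e₁ ^ 2) / Λ ^ 2) + (ω ^ 2 + e₀ ^ 2) / Λ ^ 2 =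
      (2 * e₁ * (e₂ - 2 * e₁ + e₀) + (e₂ - e₁) ^ 2 + (e₀ - e₁) ^ 2) / Λ ^ 2 := by ring

/-! ## §3 The CT cutoff weight and the complementary member: differences in the momentum -/

section Weight

variable {L M : ℕ} (β μ : ℝ) (K : TrigPolyC4v)

/-- Salmhofer's cutoff is differentiable with a differentiable derivative (it is `C^∞`). [cite: Salmhofer1999, §4.2.5 (4.71)] -/
theorem differentiable_salmhoferCutoff_and_deriv : Differentiable ℝ salmhoferCutoff ∧ Differentiable ℝ (deriv salmhoferCutoff) :=
  ⟨(contDiff_salmhoferCutoff (n := 2)).differentiable (by norm_num), (contDiff_salmhoferCutoff (n := 2)).differentiable_deriv_two⟩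

/-- **First difference of the CT weight in the momentum**: `|w_Λ(ν, p+Q) − w_Λ(ν, p)| ≤ (8/3)·|(e_K(p+Q) − e_K(p))(e_K(p+Q) + e_K(p))/Λ²|`. [folklore] -/
theorem abs_hubbardCutoffWeightCT_sub_le (Λ : ℝ) (ν : MatsubaraIdx M) (p Q : TorusSite 2 L) :
    |hubbardCutoffWeightCT L M β μ K Λ (ν, p + Q) - hubbardCutoffWeightCT L M β μ K Λ (ν, p)| ≤
      8 / 3 * |(nambuXiCT L μ K (p + Q) - nambuXiCT L μ K p) * (nambuXiCT L μ K (p + Q) + nambuXiCT L μ K p) / Λ ^ 2| := by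
  obtain ⟨hd, -⟩ := differentiable_salmhoferCutoff_and_deriv
  set u₂ := (matsubaraFreq β M ν ^ 2 + nambuXiCT L μ K (p + Q) ^ 2) / Λ ^ 2 with hu₂
  set u₁ := (matsubaraFreq β M ν ^ 2 + nambuXiCT L μ K p ^ 2) / Λ ^ 2 with hu₁
  have hmv := Convex.norm_image_sub_le_of_norm_deriv_le (f := salmhoferCutoff) (s := Set.univ) (fun z _ => hd.differentiableAt)
    (fun z _ => by rw [Real.norm_eq_abs]; exact klsh_abs_deriv_salmhoferCutoff_le z) convex_univ (Set.mem_univ u₁) (Set.mem_univ u₂)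
  rw [Real.norm_eq_abs, Real.norm_eq_abs] at hmv
  have hsub : u₂ - u₁ = (nambuXiCT L μ K (p + Q) - nambuXiCT L μ K p) * (nambuXiCT L μ K (p + Q) + nambuXiCT L μ K p) / Λ ^ 2 := by
    rw [hu₂, hu₁]; exact cutoffArg_sub _ _ _ _
  simpa only [hubbardCutoffWeightCT, hsub] using hmv

/-- **Second difference of the CT weight in the momentum**: with `u(·) = (ω_ν² + e_K(·)²)/Λ²`, `e₊ = e_K(p+Q)`, `e = e_K(p)`, `e₋ = e_K(p−Q)`,
`|w_Λ(ν,p+Q) − 2w_Λ(ν,p) + w_Λ(ν,p−Q)| ≤ (8/3)·|(2e(e₊ − 2e + e₋) + (e₊−e)² + (e₋−e)²)/Λ²| + (176/9)·(((e₊−e)(e₊+e)/Λ²)² + ((e₋−e)(e₋+e)/Λ²)²)`. [folklore] -/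
theorem abs_hubbardCutoffWeightCT_secondDiff_le (Λ : ℝ) (ν : MatsubaraIdx M) (p Q : TorusSite 2 L) :
    |hubbardCutoffWeightCT L M β μ K Λ (ν, p + Q) - 2 * hubbardCutoffWeightCT L M β μ K Λ (ν, p) + hubbardCutoffWeightCT L M β μ K Λ (ν, p - Q)| ≤
      8 / 3 * |(2 * nambuXiCT L μ K p * (nambuXiCT L μ K (p + Q) - 2 * nambuXiCT L μ K p + nambuXiCT L μ K (p - Q)) +
          (nambuXiCT L μ K (p + Q) - nambuXiCT L μ K p) ^ 2 + (nambuXiCT L μ K (p - Q) - nambuXiCT L μ K p) ^ 2) / Λ ^ 2| +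
        176 / 9 * (((nambuXiCT L μ K (p + Q) - nambuXiCT L μ K p) * (nambuXiCT L μ K (p + Q) + nambuXiCT L μ K p) / Λ ^ 2) ^ 2 +
          ((nambuXiCT L μ K (p - Q) - nambuXiCT L μ K p) * (nambuXiCT L μ K (p - Q) + nambuXiCT L μ K p) / Λ ^ 2) ^ 2) := by
  obtain ⟨hd, hd'⟩ := differentiable_salmhoferCutoff_and_deriv
  set ω := matsubaraFreq β M ν
  set e₂ := nambuXiCT L μ K (p + Q)
  set e₁ := nambuXiCT L μ K p
  set e₀ := nambuXiCT L μ K (p - Q)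
  have h := abs_secondDiff_comp_le hd hd' klsh_abs_deriv_salmhoferCutoff_le klsh_abs_deriv2_salmhoferCutoff_le
    ((ω ^ 2 + e₀ ^ 2) / Λ ^ 2) ((ω ^ 2 + e₁ ^ 2) / Λ ^ 2) ((ω ^ 2 + e₂ ^ 2) / Λ ^ 2)
  rw [cutoffArg_secondDiff, cutoffArg_sub ω e₁ e₂ Λ, cutoffArg_sub ω e₁ e₀ Λ] at h
  simpa only [hubbardCutoffWeightCT] using h

/-- **Second difference of the complementary member symbol** `softSymbolCompl … n m = w_{Λ_m} − w_{Λ_n}`: the triangle inequality over the two scales. [folklore] -/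
theorem abs_softSymbolCompl_secondDiff_le [NeZero L] [NeZero M] (n m : ℕ) (ν : MatsubaraIdx M) (p Q : TorusSite 2 L) :
    |softSymbolCompl L M β μ K n m (ν, p + Q) - 2 * softSymbolCompl L M β μ K n m (ν, p) + softSymbolCompl L M β μ K n m (ν, p - Q)| ≤
      |hubbardCutoffWeightCT L M β μ K (klScale klE0 m) (ν, p + Q) - 2 * hubbardCutoffWeightCT L M β μ K (klScale klE0 m) (ν, p) +
          hubbardCutoffWeightCT L M β μ K (klScale klE0 m) (ν, p - Q)| +
        |hubbardCutoffWeightCT L M β μ K (klScale klE0 n) (ν, p + Q) - 2 * hubbardCutoffWeightCT L M β μ K (klScale klE0 n) (ν, p) +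
          hubbardCutoffWeightCT L M β μ K (klScale klE0 n) (ν, p - Q)| := by
  simp only [softSymbolCompl]
  rw [show ∀ a₂ a₁ a₀ b₂ b₁ b₀ : ℝ, a₂ - b₂ - 2 * (a₁ - b₁) + (a₀ - b₀) = (a₂ - 2 * a₁ + a₀) - (b₂ - 2 * b₁ + b₀) from fun _ _ _ _ _ _ => by ring]
  exact abs_sub _ _

end Weight

end Summit.HubbardSuperconductivity.HubbardSuperconductivity.Theorems.KLRegimeSplit

end
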